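import Literature.RingTheory.FormalGroups.PadicLogTypeSeries
import HarnessLib

/-!
# Taylor congruence, Honda's functional equation and Frobenius annihilation for `p`-adic log-type sums

Topic `Literature/RingTheory/FormalGroups`; namespace `Literature.RingTheory.FormalGroups.PadicLogSeries`. THEOREMS ONLY
(no definition, no named fact, no instance, no `sorry`). Sequel of `PadicLogTypeSeries` (the `p`-adic sums
`Λᵇ_N(y,z) = p^N · Σ (b_m/m) yᵐ ∈ B^_(p)` at a `p`-nilpotent `y`, `y^N = p z`, of a commutative ring `B` with
`ι : ℤ_p → B`). Here `B` is a domain of characteristic `0` (so that `m` can be cancelled) and everything is a congruence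
modulo `p^{N+1}` holding at EVERY level `pⁿ` of the completion:

* §1 vanishing principle in `B^_(p)` (`eq_zero_of_forall_evalₐ_eq`);
* §2 ★ the TAYLOR CONGRUENCE `Λ(y + p h) ≡ Λ(y) (mod p^{N+1})` (`exists_evalₐ_logSum_add_sub_logSum_eq`): termwise
  `m·(T_m(y+ph) − T_m(y)) = ι(b_m) p^N Σ_{k≥1} C(m,k) pᵏ hᵏ y^{m−k}` and `C(m,k)pᵏ/m = C(m−1,k−1)·pᵏ/k ∈ pℤ_p`
  (`exists_natCast_mul_eq_pow_sub_one`: `v_p(k) ≤ k − 1`);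
* §3 ★★ HONDA'S FUNCTIONAL EQUATION (`exists_evalₐ_honda_eq`): if `ℓ_b = Σ (b_m/m)Xᵐ` is of Honda type `p − aT + T²`,
  i.e. `m ∣ B_m := b_m − [p∣m]·a·b_{m/p} + [p²∣m]·p·b_{m/p²}` in `ℤ_p` for all `m` (equivalently
  `ℓ_b − (a/p)ℓ_b(Xᵖ) + (1/p)ℓ_b(X^{p²}) ∈ ℤ_p⟦X⟧`, the tree's `hondaShift p a ℓ_b ∈ ℤ_p⟦X⟧`; for the logarithm of an
  elliptic curve with good reduction at `p` this is `WeierstrassCurve.norm_coeff_hondaShift_formalLog_le_one`, `a = a_p`),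
  then `p·Λᵇ(y) − ι(a)·Λᵇ(yᵖ) + Λᵇ(y^{p²}) ≡ 0 (mod p^{N+1})`;
* §4 ★★★ FROBENIUS ANNIHILATION (`exists_evalₐ_frobenius_honda_eq`): for a ring endomorphism `φ` of `B` fixing `ι(ℤ_p)` with
  `φ(y) = yᵖ + p h₁` (a Frobenius lift at `y`, as on `𝔸_inf = W(𝒪♭)`), `φ²Λᵇ(y) − ι(a)·φΛᵇ(y) + p·Λᵇ(y) ≡ 0 (mod p^{N+1})`
  — §2 twice + §3 once, `φ` acting through the arguments (`adicCompletionMap_logSum`).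

This is brick B2+B3 of the φ-road to the `X₂`-membership (K₂) of line `kato_lever` (crux K★ `stmt-BirchSwinnertonDyer-22226`,
memo `Lines/kato-lever-K2-phi-road.md`): applied in `A_max = PAdicHodge.BmaxPlus` to the canonical lifts of `[p]`-division
sequences of a formal group of height `2`, where the error `p^{N+1}` is removed by passing to deeper division points, it yields
the exact Dieudonné–Honda relation `φ²L − a_pφL + pL = 0` of the periods. Infrastructure only: BSD / K★ are not proved by
any of this.

## References
* T. Honda, *On the theory of commutative formal groups*, J. Math. Soc. Japan 22 (1970), Thm. 2 (p. 223), §6.2. [Honda1970]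
* M. Hazewinkel, *Formal Groups and Applications* (1978), Ch. I §2.1–2.3 (functional equation lemma). [Hazewinkel1978]
* P. Colmez, *Périodes p-adiques des variétés abéliennes*, Math. Ann. 292 (1992), §2. [Colmez1992PeriodesAbeliennes]
* L. Berger, *Représentations p-adiques et équations différentielles*, Invent. Math. 148 (2002), §1.2. [BergerLaurent2002]
-/

noncomputable section

open Finset


namespace Literature.RingTheory.FormalGroups

namespace PadicLogSeries

open Literature.AlgebraicGeometry.Resolution

variable {p : ℕ} [hp : Fact p.Prime]

universe u

variable {B : Type u} [CommRing B] (ι : ℤ_[p] →+* B) (b : ℕ → ℤ_[p])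

/-! ## §1 Vanishing and divisibility at all levels of the `p`-adic completion -/

omit hp in
/-- **Vanishing principle**: an element of `B^_(p)` which is divisible by `pⁿ` modulo `pⁿ` for every `n` is `0`.
[cite: BergerLaurent2002, §1.2] -/
theorem eq_zero_of_forall_evalₐ_eq {X : AdicCompletion (Ideal.span {(p : B)}) B}
    (h : ∀ n, ∃ w : B, AdicCompletion.evalₐ (Ideal.span {(p : B)}) n X = Ideal.Quotient.mk _ ((p : B) ^ n * w)) :
    X = 0 := by
  refine AdicCompletion.ext_evalₐ fun n => ?_
  obtain ⟨w, hw⟩ := h n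
  rw [hw, map_zero, Ideal.Quotient.eq_zero_iff_mem, Ideal.span_singleton_pow]
  exact Ideal.mul_mem_right _ _ (Ideal.mem_span_singleton_self _)

omit hp in
/-- Divisibility by `p^j` modulo `pⁿ` for all `n` and ALL `j` forces vanishing. [cite: BergerLaurent2002, §1.2] -/
theorem eq_zero_of_forall_forall_evalₐ_eq {X : AdicCompletion (Ideal.span {(p : B)}) B}
    (h : ∀ j n, ∃ w : B, AdicCompletion.evalₐ (Ideal.span {(p : B)}) n X = Ideal.Quotient.mk _ ((p : B) ^ j * w)) :
    X = 0 :=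
  eq_zero_of_forall_evalₐ_eq fun n => h n n

/-! ## §2 The Taylor congruence `Λ(y + p h) ≡ Λ(y) (mod p^{N+1})` -/

/-- `v_p(k) ≤ k − 1` for `k ≥ 1` (`k ≥ p^{v_p(k)} ≥ 2^{v} ≥ v + 1`). [folklore] -/
private theorem factorization_le_sub_one {k : ℕ} (hk : k ≠ 0) : k.factorization p ≤ k - 1 := by
  have h1 : p ^ k.factorization p ≤ k := Nat.ordProj_le p hk
  have h2 : 2 ^ k.factorization p ≤ p ^ k.factorization p := Nat.pow_le_pow_left hp.out.two_le _
  have h3 : k.factorization p < 2 ^ k.factorization p := Nat.lt_two_pow_self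
  omega

/-- `p ∤ n ⇒ n ∈ ℤ_p^×`. [folklore] -/
private theorem isUnit_natCast_of_not_dvd' {n : ℕ} (h : ¬ p ∣ n) : IsUnit (n : ℤ_[p]) :=
  PadicInt.isUnit_iff.2 (PadicInt.norm_natCast_eq_one_iff.2 ((Nat.Prime.coprime_iff_not_dvd hp.out).2 h))

/-- `k · d = p^e` is solvable in `ℤ_p` whenever `v_p(k) ≤ e`. [folklore] -/
private theorem exists_natCast_mul_eq_pow' {k e : ℕ} (hk : k ≠ 0) (he : k.factorization p ≤ e) :
    ∃ d : ℤ_[p], (k : ℤ_[p]) * d = (p : ℤ_[p]) ^ e := by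
  obtain ⟨u, hu⟩ := isUnit_natCast_of_not_dvd' (p := p) (Nat.not_dvd_ordCompl hp.out hk)
  have hkm : p ^ k.factorization p * (k / p ^ k.factorization p) = k := Nat.ordProj_mul_ordCompl_eq_self k p
  refine ⟨(p : ℤ_[p]) ^ (e - k.factorization p) * ((u⁻¹ : ℤ_[p]ˣ) : ℤ_[p]), ?_⟩
  calc (k : ℤ_[p]) * ((p : ℤ_[p]) ^ (e - k.factorization p) * ((u⁻¹ : ℤ_[p]ˣ) : ℤ_[p]))
      = ((p ^ k.factorization p * (k / p ^ k.factorization p) : ℕ) : ℤ_[p]) *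
          ((p : ℤ_[p]) ^ (e - k.factorization p) * ((u⁻¹ : ℤ_[p]ˣ) : ℤ_[p])) := by rw [hkm]
    _ = (p : ℤ_[p]) ^ k.factorization p * (p : ℤ_[p]) ^ (e - k.factorization p) *
          ((u : ℤ_[p]) * ((u⁻¹ : ℤ_[p]ˣ) : ℤ_[p])) := by rw [hu]; push_cast; ring
    _ = (p : ℤ_[p]) ^ e := by rw [← pow_add, Nat.add_sub_cancel' he, Units.mul_inv, mul_one]

/-- **`p^k/k ∈ p ℤ_p` for `k ≥ 1`**: there is `f ∈ ℤ_p` with `k · f = p^{k−1}`. [cite: BergerLaurent2002, §1.2] -/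
theorem exists_natCast_mul_eq_pow_sub_one {k : ℕ} (hk : k ≠ 0) :
    ∃ f : ℤ_[p], (k : ℤ_[p]) * f = (p : ℤ_[p]) ^ (k - 1) :=
  exists_natCast_mul_eq_pow' hk (factorization_le_sub_one hk)

/-- **The binomial Taylor step at the level of terms**: for `y^N = p z`, `(y + p h)^N = p z'` and `m ≥ 1` there is
`w ∈ B` with `T_m(y + p h, z') − T_m(y, z) = p^{N+1} · w` — because
`m · (T_m(y+ph) − T_m(y)) = ι(b_m) p^N ((y+ph)ᵐ − yᵐ) = ι(b_m) p^N Σ_{k≥1} C(m,k) pᵏ hᵏ y^{m−k}` and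
`C(m,k) pᵏ/m = C(m−1,k−1) · pᵏ/k ∈ p ℤ_p` (`B` a domain of characteristic `0`). [cite: Colmez1992PeriodesAbeliennes, §2] -/
theorem exists_term_add_sub_term_eq [IsDomain B] [CharZero B] {N : ℕ} (hN : 1 ≤ N) {y z h z' : B}
    (hyz : y ^ N = (p : B) * z) (hyz' : (y + (p : B) * h) ^ N = (p : B) * z') (m : ℕ) :
    ∃ w : B, term ι b N (y + (p : B) * h) z' m - term ι b N y z m = (p : B) ^ (N + 1) * w := by
  rcases eq_or_ne m 0 with rfl | hm
  · exact ⟨0, by simp⟩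
  -- the coefficients `f_k` with `k f_k = p^{k-1}`
  have hf : ∀ k : ℕ, ∃ f : ℤ_[p], k ≠ 0 → (k : ℤ_[p]) * f = (p : ℤ_[p]) ^ (k - 1) := fun k => by
    rcases eq_or_ne k 0 with rfl | hk
    · exact ⟨0, fun h => (h rfl).elim⟩
    · obtain ⟨f, hf⟩ := exists_natCast_mul_eq_pow_sub_one (p := p) hk
      exact ⟨f, fun _ => hf⟩
  choose f hf using hf
  -- candidate: w = ι(b_m) Σ_{k=0}^{m-1} ι(C(m-1,k) f_{k+1}) h^{k+1} y^{m-1-k}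
  refine ⟨ι (b m) * ∑ k ∈ range m, ι ((Nat.choose (m - 1) k : ℤ_[p]) * f (k + 1)) * h ^ (k + 1) * y ^ (m - (k + 1)), ?_⟩
  refine mul_left_cancel₀ (Nat.cast_ne_zero.2 hm : (m : B) ≠ 0) ?_
  rw [mul_sub, natCast_mul_term ι b hN hyz' hm, natCast_mul_term ι b hN hyz hm]
  -- expand `(y + p h)^m` binomially and split off the `k = 0` term
  have hbin : (y + (p : B) * h) ^ m = y ^ m + ∑ k ∈ range m, ((p : B) * h) ^ (k + 1) * y ^ (m - (k + 1)) *
      (Nat.choose m (k + 1) : B) := by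
    rw [add_comm y, add_pow, sum_range_succ', pow_zero, Nat.sub_zero, Nat.choose_zero_right, Nat.cast_one, one_mul,
      mul_one, add_comm]
  rw [hbin, mul_add, add_sub_cancel_left]
  simp only [mul_sum]
  refine sum_congr rfl fun k hk => ?_
  -- `m C(m-1,k) = (k+1) C(m,k+1)`
  have hchoose : (m : ℤ_[p]) * (Nat.choose (m - 1) k : ℤ_[p]) = ((k + 1 : ℕ) : ℤ_[p]) * (Nat.choose m (k + 1) : ℤ_[p]) := by
    have h := Nat.add_one_mul_choose_eq (m - 1) k
    rw [Nat.sub_add_cancel (Nat.one_le_iff_ne_zero.2 hm), mul_comm (Nat.choose m (k + 1))] at h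
    exact_mod_cast h
  have hf' := hf (k + 1) (Nat.succ_ne_zero k)
  rw [Nat.add_sub_cancel] at hf'
  -- `m · ι(C(m-1,k) f_{k+1}) = C(m,k+1) · ι((k+1) f_{k+1}) = C(m,k+1) · p^k`
  have key : (m : B) * ι ((Nat.choose (m - 1) k : ℤ_[p]) * f (k + 1)) = (Nat.choose m (k + 1) : B) * (p : B) ^ k := by
    rw [← map_natCast ι m, ← map_mul, ← mul_assoc, hchoose, mul_right_comm, hf', map_mul, map_pow, map_natCast,
      map_natCast, mul_comm]
  calc ι (b m) * (p : B) ^ N * (((p : B) * h) ^ (k + 1) * y ^ (m - (k + 1)) * (Nat.choose m (k + 1) : B))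
      = ι (b m) * (p : B) ^ N * (p : B) ^ (k + 1) * h ^ (k + 1) * y ^ (m - (k + 1)) * (Nat.choose m (k + 1) : B) := by
        rw [mul_pow]; ring
    _ = (p : B) ^ (N + 1) * (ι (b m) * (((Nat.choose m (k + 1) : B) * (p : B) ^ k) * h ^ (k + 1) * y ^ (m - (k + 1)))) := by
        rw [pow_succ, pow_succ]; ring
    _ = (m : B) * ((p : B) ^ (N + 1) * (ι (b m) * (ι ((Nat.choose (m - 1) k : ℤ_[p]) * f (k + 1)) * h ^ (k + 1) *
          y ^ (m - (k + 1))))) := by rw [← key]; ring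

/-- **Taylor congruence for the partial sums**: `S_M(y + p h, z') − S_M(y, z) = p^{N+1} · w`.
[cite: Colmez1992PeriodesAbeliennes, §2] -/
theorem exists_partialSum_add_sub_partialSum_eq [IsDomain B] [CharZero B] {N : ℕ} (hN : 1 ≤ N) {y z h z' : B}
    (hyz : y ^ N = (p : B) * z) (hyz' : (y + (p : B) * h) ^ N = (p : B) * z') (M : ℕ) :
    ∃ w : B, partialSum ι b N (y + (p : B) * h) z' M - partialSum ι b N y z M = (p : B) ^ (N + 1) * w := by
  induction M with
  | zero => exact ⟨0, by simp⟩
  | succ M ih =>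
    obtain ⟨w, hw⟩ := ih
    obtain ⟨w', hw'⟩ := exists_term_add_sub_term_eq ι b hN hyz hyz' (M + 1)
    exact ⟨w + w', by rw [partialSum_succ, partialSum_succ, add_sub_add_comm, hw, hw']; ring⟩

/-- ★ **Taylor congruence: `Λ(y + p h) ≡ Λ(y) (mod p^{N+1})` at every level of `B^_(p)`** (`y^N = p z`,
`(y + p h)^N = p z'`, `B` a domain of characteristic `0`): for every `n` there is `w ∈ B` with
`Λ(y+ph, z') − Λ(y, z) ≡ p^{N+1} w (mod pⁿ)`. This is the estimate behind `log(φ x) ≡ log(xᵖ)` for a Frobenius lift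
`φ x = xᵖ + p·δ(x)`. [cite: Colmez1992PeriodesAbeliennes, §2] -/
theorem exists_evalₐ_logSum_add_sub_logSum_eq [IsDomain B] [CharZero B] {N : ℕ} (hN : 1 ≤ N) {y z h z' : B}
    (hyz : y ^ N = (p : B) * z) (hyz' : (y + (p : B) * h) ^ N = (p : B) * z') (n : ℕ) :
    ∃ w : B, AdicCompletion.evalₐ (Ideal.span {(p : B)}) n (logSum ι b N (y + (p : B) * h) z' - logSum ι b N y z) =
      Ideal.Quotient.mk _ ((p : B) ^ (N + 1) * w) := by
  obtain ⟨w, hw⟩ := exists_partialSum_add_sub_partialSum_eq ι b hN hyz hyz' (2 * n * N)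
  exact ⟨w, by rw [map_sub, evalₐ_logSum ι b _ _ hN, evalₐ_logSum ι b _ _ hN, ← map_sub, hw]⟩

/-! ## §3 Honda's functional equation: `p·Λᵇ(y) − a·Λᵇ(yᵖ) + Λᵇ(y^{p²}) ≡ 0 (mod p^{N+1})` -/

omit hp in
/-- Reindexing a sum supported on the multiples of `q`: `Σ_{m < qK} [q ∣ m+1]·G((m+1)/q) = Σ_{j < K} G(j+1)`. [folklore] -/
private theorem sum_ite_dvd_eq {q : ℕ} (hq : 0 < q) (K : ℕ) (G : ℕ → B) :
    ∑ m ∈ range (q * K), (if q ∣ m + 1 then G ((m + 1) / q) else 0) = ∑ j ∈ range K, G (j + 1) := by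
  rw [← sum_filter]
  have hset : (range (q * K)).filter (fun m => q ∣ m + 1) = (range K).image (fun j => q * (j + 1) - 1) := by
    ext m
    simp only [mem_filter, mem_range, mem_image]
    constructor
    · rintro ⟨hm, c, hc⟩
      have hc0 : c ≠ 0 := by rintro rfl; simp at hc
      refine ⟨c - 1, ?_, ?_⟩
      · have : q * c ≤ q * K := by rw [← hc]; omega
        have := Nat.le_of_mul_le_mul_left this hq
        omega
      · rw [Nat.sub_add_cancel (Nat.one_le_iff_ne_zero.2 hc0), ← hc, Nat.add_sub_cancel]
    · rintro ⟨j, hj, rfl⟩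
      have h1 : 1 ≤ q * (j + 1) := Nat.one_le_iff_ne_zero.2 (Nat.mul_ne_zero hq.ne' (Nat.succ_ne_zero j))
      refine ⟨?_, j + 1, ?_⟩
      · have : q * (j + 1) ≤ q * K := Nat.mul_le_mul_left q (by omega)
        omega
      · omega
  rw [hset, sum_image]
  · refine sum_congr rfl fun j _ => ?_
    have h1 : 1 ≤ q * (j + 1) := Nat.one_le_iff_ne_zero.2 (Nat.mul_ne_zero hq.ne' (Nat.succ_ne_zero j))
    rw [Nat.sub_add_cancel h1, Nat.mul_div_cancel_left (j + 1) hq]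
  · intro j₁ _ j₂ _ h
    have h1 : 1 ≤ q * (j₁ + 1) := Nat.one_le_iff_ne_zero.2 (Nat.mul_ne_zero hq.ne' (Nat.succ_ne_zero j₁))
    have h2 : 1 ≤ q * (j₂ + 1) := Nat.one_le_iff_ne_zero.2 (Nat.mul_ne_zero hq.ne' (Nat.succ_ne_zero j₂))
    have h' : q * (j₁ + 1) = q * (j₂ + 1) := by
      have := congrArg (· + 1) h; simp only [Nat.sub_add_cancel h1, Nat.sub_add_cancel h2] at this; exact this
    have := Nat.eq_of_mul_eq_mul_left hq h'
    omega

/-- **Honda's congruence at the level of terms.** Let `B_m := b_m − [p∣m]·a·b_{m/p} + [p²∣m]·p·b_{m/p²}` and suppose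
`m ∣ B_m` in `ℤ_p` for all `m ≥ 1` — i.e. `ℓ_b(X) − (a/p)ℓ_b(Xᵖ) + (1/p)ℓ_b(X^{p²}) ∈ ℤ_p⟦X⟧`: `ℓ_b` is of Honda type
`p − aT + T²` (tree `hondaShift`). Then for `y^N = pz`, `(yᵖ)^N = pz₁`, `(y^{p²})^N = pz₂` and every `m ≥ 1` the
combination `U_m = p·T_m(y) − a·[p∣m]·T_{m/p}(yᵖ) + [p²∣m]·T_{m/p²}(y^{p²})` equals `p^{N+1} ι(e_m) yᵐ` where
`m e_m = B_m` (`B` a domain of characteristic `0`). [cite: Honda1970, Thm. 2 (p. 223) and §6.2] [cite: Hazewinkel1978, Ch. I §2.1–2.3] -/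
theorem honda_term_eq [IsDomain B] [CharZero B] {N : ℕ} (hN : 1 ≤ N) {y z z₁ z₂ : B} (hyz : y ^ N = (p : B) * z)
    (hyz₁ : (y ^ p) ^ N = (p : B) * z₁) (hyz₂ : (y ^ (p ^ 2)) ^ N = (p : B) * z₂) (a : ℤ_[p]) {m : ℕ} (hm : m ≠ 0)
    {e : ℤ_[p]} (he : (m : ℤ_[p]) * e =
      b m - (if p ∣ m then a * b (m / p) else 0) + (if p ^ 2 ∣ m then (p : ℤ_[p]) * b (m / p ^ 2) else 0)) :
    (p : B) * term ι b N y z m - (if p ∣ m then ι a * term ι b N (y ^ p) z₁ (m / p) else 0) +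
        (if p ^ 2 ∣ m then term ι b N (y ^ (p ^ 2)) z₂ (m / p ^ 2) else 0) =
      (p : B) ^ (N + 1) * ι e * y ^ m := by
  refine mul_left_cancel₀ (Nat.cast_ne_zero.2 hm : (m : B) ≠ 0) ?_
  -- the three pieces of `m · U_m`
  have h1 : (m : B) * ((p : B) * term ι b N y z m) = (p : B) ^ (N + 1) * ι (b m) * y ^ m := by
    rw [mul_left_comm, natCast_mul_term ι b hN hyz hm]; ring
  have h2 : (m : B) * (if p ∣ m then ι a * term ι b N (y ^ p) z₁ (m / p) else 0) =
      (p : B) ^ (N + 1) * ι (if p ∣ m then a * b (m / p) else 0) * y ^ m := by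
    split_ifs with hdvd
    · obtain ⟨j, rfl⟩ := hdvd
      have hj : j ≠ 0 := by rintro rfl; exact hm (by simp)
      have hT := natCast_mul_term ι b hN hyz₁ hj
      rw [Nat.mul_div_cancel_left j hp.out.pos, Nat.cast_mul, map_mul]
      calc (p : B) * (j : B) * (ι a * term ι b N (y ^ p) z₁ j) = (p : B) * ι a * ((j : B) * term ι b N (y ^ p) z₁ j) := by
            ring
        _ = (p : B) ^ (N + 1) * (ι a * ι (b j)) * y ^ (p * j) := by rw [hT, ← pow_mul, pow_succ]; ring
    · simp
  have h3 : (m : B) * (if p ^ 2 ∣ m then term ι b N (y ^ (p ^ 2)) z₂ (m / p ^ 2) else 0) =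
      (p : B) ^ (N + 1) * ι (if p ^ 2 ∣ m then (p : ℤ_[p]) * b (m / p ^ 2) else 0) * y ^ m := by
    split_ifs with hdvd
    · obtain ⟨j, rfl⟩ := hdvd
      have hj : j ≠ 0 := by rintro rfl; exact hm (by simp)
      have hT := natCast_mul_term ι b hN hyz₂ hj
      rw [Nat.mul_div_cancel_left j (pow_pos hp.out.pos 2), Nat.cast_mul, map_mul, map_natCast, Nat.cast_pow]
      calc (p : B) ^ 2 * (j : B) * term ι b N (y ^ (p ^ 2)) z₂ j = (p : B) ^ 2 * ((j : B) * term ι b N (y ^ (p ^ 2)) z₂ j) := by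
            ring
        _ = (p : B) ^ (N + 1) * ((p : B) * ι (b j)) * y ^ (p ^ 2 * j) := by rw [hT, ← pow_mul, pow_succ]; ring
    · simp
  rw [mul_add, mul_sub, h1, h2, h3]
  have h4 : (m : B) * ((p : B) ^ (N + 1) * ι e * y ^ m) = (p : B) ^ (N + 1) * ι ((m : ℤ_[p]) * e) * y ^ m := by
    rw [map_mul, map_natCast]; ring
  rw [h4, he, map_add, map_sub]
  ring

/-- **Honda's congruence for the partial sums** (truncation at a multiple of `p²`): with `B_m`, `e_m` as in
`honda_term_eq`, `p·S_{p²K}(y) − a·S_{pK}(yᵖ) + S_{K}(y^{p²}) = p^{N+1} · Σ_{m ≤ p²K} ι(e_m) yᵐ`.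
[cite: Honda1970, Thm. 2 (p. 223) and §6.2] [cite: Hazewinkel1978, Ch. I §2.1–2.3] -/
theorem honda_partialSum_eq [IsDomain B] [CharZero B] {N : ℕ} (hN : 1 ≤ N) {y z z₁ z₂ : B} (hyz : y ^ N = (p : B) * z)
    (hyz₁ : (y ^ p) ^ N = (p : B) * z₁) (hyz₂ : (y ^ (p ^ 2)) ^ N = (p : B) * z₂) (a : ℤ_[p]) (e : ℕ → ℤ_[p])
    (he : ∀ m : ℕ, m ≠ 0 → (m : ℤ_[p]) * e m =
      b m - (if p ∣ m then a * b (m / p) else 0) + (if p ^ 2 ∣ m then (p : ℤ_[p]) * b (m / p ^ 2) else 0))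
    (K : ℕ) :
    (p : B) * partialSum ι b N y z (p ^ 2 * K) - ι a * partialSum ι b N (y ^ p) z₁ (p * K) +
        partialSum ι b N (y ^ (p ^ 2)) z₂ K =
      (p : B) ^ (N + 1) * ∑ m ∈ range (p ^ 2 * K), ι (e (m + 1)) * y ^ (m + 1) := by
  have hp0 : 0 < p := hp.out.pos
  -- rewrite the two shorter sums as sums over `range (p^2 K)` supported on multiples of `p`, `p²`
  have hS₁ : ι a * partialSum ι b N (y ^ p) z₁ (p * K) =
      ∑ m ∈ range (p ^ 2 * K), (if p ∣ (m + 1) then ι a * term ι b N (y ^ p) z₁ ((m + 1) / p) else 0) := by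
    rw [partialSum, mul_sum, show p ^ 2 * K = p * (p * K) by ring,
      sum_ite_dvd_eq hp0 (p * K) (fun j => ι a * term ι b N (y ^ p) z₁ j)]
  have hS₂ : partialSum ι b N (y ^ (p ^ 2)) z₂ K =
      ∑ m ∈ range (p ^ 2 * K), (if p ^ 2 ∣ (m + 1) then term ι b N (y ^ (p ^ 2)) z₂ ((m + 1) / p ^ 2) else 0) := by
    rw [partialSum, sum_ite_dvd_eq (pow_pos hp0 2) K (fun j => term ι b N (y ^ (p ^ 2)) z₂ j)]
  rw [hS₁, hS₂, partialSum, mul_sum, ← sum_sub_distrib, ← sum_add_distrib, mul_sum]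
  refine sum_congr rfl fun m _ => ?_
  rw [honda_term_eq ι b hN hyz hyz₁ hyz₂ a (Nat.add_one_ne_zero m) (he (m + 1) (Nat.add_one_ne_zero m))]
  ring

/-- ★★ **Honda's congruence in `B^_(p)`**: if `ℓ_b` is of Honda type `p − aT + T²` (hypothesis `he`, see
`honda_term_eq`), then for every `p`-nilpotent `y` with witnesses `z, z₁, z₂` for `y, yᵖ, y^{p²}`:
**`p·Λᵇ(y) − ι(a)·Λᵇ(yᵖ) + Λᵇ(y^{p²}) ≡ p^{N+1}·w (mod pⁿ)`** at every level `n`. This is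
`p·log(x) − a·log(xᵖ) + log(x^{p²}) ∈ p·(integral)` evaluated `p`-adically. [cite: Honda1970, Thm. 2 (p. 223) and §6.2]
[cite: Hazewinkel1978, Ch. I §2.1–2.3] -/
theorem exists_evalₐ_honda_eq [IsDomain B] [CharZero B] {N : ℕ} (hN : 1 ≤ N) {y z z₁ z₂ : B} (hyz : y ^ N = (p : B) * z)
    (hyz₁ : (y ^ p) ^ N = (p : B) * z₁) (hyz₂ : (y ^ (p ^ 2)) ^ N = (p : B) * z₂) (a : ℤ_[p]) (e : ℕ → ℤ_[p])
    (he : ∀ m : ℕ, m ≠ 0 → (m : ℤ_[p]) * e m =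
      b m - (if p ∣ m then a * b (m / p) else 0) + (if p ^ 2 ∣ m then (p : ℤ_[p]) * b (m / p ^ 2) else 0))
    (n : ℕ) :
    ∃ w : B, AdicCompletion.evalₐ (Ideal.span {(p : B)}) n
        (AdicCompletion.of (Ideal.span {(p : B)}) B (p : B) * logSum ι b N y z -
          AdicCompletion.of (Ideal.span {(p : B)}) B (ι a) * logSum ι b N (y ^ p) z₁ + logSum ι b N (y ^ (p ^ 2)) z₂) =
      Ideal.Quotient.mk _ ((p : B) ^ (N + 1) * w) := by
  refine ⟨∑ m ∈ range (p ^ 2 * (2 * n * N)), ι (e (m + 1)) * y ^ (m + 1), ?_⟩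
  have hM₀ : 2 * n * N ≤ p ^ 2 * (2 * n * N) := Nat.le_mul_of_pos_left _ (pow_pos hp.out.pos 2)
  have hM₁ : 2 * n * N ≤ p * (2 * n * N) := Nat.le_mul_of_pos_left _ hp.out.pos
  rw [map_add, map_sub, map_mul, map_mul, AdicCompletion.evalₐ_of, AdicCompletion.evalₐ_of,
    evalₐ_logSum_of_le ι b y z hN hM₀, evalₐ_logSum_of_le ι b (y ^ p) z₁ hN hM₁, evalₐ_logSum ι b (y ^ (p ^ 2)) z₂ hN,
    ← map_mul, ← map_mul, ← map_sub, ← map_add, honda_partialSum_eq ι b hN hyz hyz₁ hyz₂ a e he]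

/-! ## §4 Frobenius annihilation: `φ²Λ(y) − a·φΛ(y) + p·Λ(y) ≡ 0 (mod p^{N+1})` for a Frobenius lift `φ` -/

section Frobenius

variable (φ : B →+* B)

omit hp in
/-- `φ` maps `(p)` into `(p)`. [cite: BergerLaurent2002, §1.2] -/
theorem map_span_natCast_le_self : (Ideal.span {(p : B)}).map φ ≤ Ideal.span {(p : B)} :=
  map_span_natCast_le φ

omit hp in
/-- From `φ(y) = yᵖ + p h₁`: `φ(φ y) = y^{p²} + p h₂` with an explicit `h₂`. [cite: BergerLaurent2002, §1.2] -/
theorem exists_frob_frob_eq {y h₁ : B} (hφ : φ y = y ^ p + (p : B) * h₁) :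
    ∃ h₂ : B, φ (φ y) = y ^ (p ^ 2) + (p : B) * h₂ := by
  -- `(y^p + p h₁)^p = y^{p²} + p(...)` and `φ(p h₁) = p φ(h₁)`
  obtain ⟨c, hc⟩ : ∃ c : B, (y ^ p + (p : B) * h₁) ^ p = (y ^ p) ^ p + (p : B) * c := by
    have h := add_pow (y ^ p) ((p : B) * h₁) p
    rw [sum_range_succ, Nat.sub_self, pow_zero, mul_one, Nat.choose_self, Nat.cast_one, mul_one] at h
    refine ⟨∑ k ∈ range p, (y ^ p) ^ k * ((p : B) ^ (p - k - 1) * h₁ ^ (p - k)) * (Nat.choose p k : B), ?_⟩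
    rw [h, add_comm, mul_sum]
    congr 1
    refine sum_congr rfl fun k hk => ?_
    have hk' : k < p := mem_range.1 hk
    rw [mul_pow, show (p : B) ^ (p - k) = p * (p : B) ^ (p - k - 1) by
      rw [← pow_succ']; congr 1; omega]
    ring
  refine ⟨φ h₁ + c, ?_⟩
  rw [hφ, map_add, map_mul, map_natCast, map_pow, hφ, hc, ← pow_mul, ← pow_two]
  ring

/-- ★★★ **Frobenius annihilation.** Let `φ` be a ring endomorphism of `B` fixing `ι(ℤ_p)` and let `y ∈ B` be
`p`-nilpotent (`y^N = p z`) with `φ(y) ≡ yᵖ (mod p)` — a lift of Frobenius at `y`, as on `𝔸_inf = W(𝒪♭)`. If `ℓ_b` is of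
Honda type `p − aT + T²` then **`φ²Λᵇ(y) − ι(a)·φΛᵇ(y) + p·Λᵇ(y) ≡ p^{N+1}·w (mod pⁿ)`** at every level `n`, where `φ`
acts on `B^_(p)` by functoriality (and on `Λ` through its arguments, `adicCompletionMap_logSum`). For the logarithm of a
one-dimensional formal group of height `2` over `ℤ_p` this is the Dieudonné–Honda relation `F² − a_pF + p = 0` of its
periods up to the `p`-adic error that the normalisation `p^N` and deeper division points remove.
[cite: Honda1970, Thm. 2 (p. 223) and §6.2] [cite: Colmez1992PeriodesAbeliennes, §2] -/
theorem exists_evalₐ_frobenius_honda_eq [IsDomain B] [CharZero B] (hφι : φ.comp ι = ι) {N : ℕ} (hN : 1 ≤ N)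
    {y z h₁ : B} (hyz : y ^ N = (p : B) * z) (hφy : φ y = y ^ p + (p : B) * h₁) (a : ℤ_[p]) (e : ℕ → ℤ_[p])
    (he : ∀ m : ℕ, m ≠ 0 → (m : ℤ_[p]) * e m =
      b m - (if p ∣ m then a * b (m / p) else 0) + (if p ^ 2 ∣ m then (p : ℤ_[p]) * b (m / p ^ 2) else 0))
    (n : ℕ) :
    ∃ w : B, AdicCompletion.evalₐ (Ideal.span {(p : B)}) n
        (adicCompletionMap _ _ φ (map_span_natCast_le_self φ)
            (adicCompletionMap _ _ φ (map_span_natCast_le_self φ) (logSum ι b N y z)) -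
          AdicCompletion.of (Ideal.span {(p : B)}) B (ι a) *
            adicCompletionMap _ _ φ (map_span_natCast_le_self φ) (logSum ι b N y z) +
          AdicCompletion.of (Ideal.span {(p : B)}) B (p : B) * logSum ι b N y z) =
      Ideal.Quotient.mk _ ((p : B) ^ (N + 1) * w) := by
  -- Frobenius acts through the arguments
  have e1 : adicCompletionMap _ _ φ (map_span_natCast_le_self φ) (logSum ι b N y z) = logSum ι b N (φ y) (φ z) := by
    rw [adicCompletionMap_logSum, hφι]
  have e2 : adicCompletionMap _ _ φ (map_span_natCast_le_self φ)
      (adicCompletionMap _ _ φ (map_span_natCast_le_self φ) (logSum ι b N y z)) = logSum ι b N (φ (φ y)) (φ (φ z)) := by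
    rw [e1, adicCompletionMap_logSum, hφι]
  -- witnesses
  have hφyz : (φ y) ^ N = (p : B) * φ z := by rw [← map_pow, hyz, map_mul, map_natCast]
  have hφφyz : (φ (φ y)) ^ N = (p : B) * φ (φ z) := by rw [← map_pow, hφyz, map_mul, map_natCast]
  obtain ⟨h₂, hφφy⟩ := exists_frob_frob_eq φ hφy
  have hyz₁ : (y ^ p) ^ N = (p : B) * ((p : B) ^ (p - 1) * z ^ p) := by
    rw [← pow_mul, mul_comm, pow_mul, hyz, mul_pow, ← mul_assoc, ← pow_succ', Nat.sub_add_cancel hp.out.one_lt.le]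
  have hyz₂ : (y ^ (p ^ 2)) ^ N = (p : B) * ((p : B) ^ (p ^ 2 - 1) * z ^ (p ^ 2)) := by
    rw [← pow_mul, mul_comm, pow_mul, hyz, mul_pow, ← mul_assoc, ← pow_succ',
      Nat.sub_add_cancel (Nat.one_le_pow _ _ hp.out.pos)]
  have hyz₂' : (y ^ (p ^ 2) + (p : B) * h₂) ^ N = (p : B) * φ (φ z) := by rw [← hφφy]; exact hφφyz
  have hyz₁' : (y ^ p + (p : B) * h₁) ^ N = (p : B) * φ z := by rw [← hφy]; exact hφyz
  -- Taylor twice, Honda once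
  obtain ⟨w₂, hw₂⟩ := exists_evalₐ_logSum_add_sub_logSum_eq ι b hN hyz₂ hyz₂' n
  obtain ⟨w₁, hw₁⟩ := exists_evalₐ_logSum_add_sub_logSum_eq ι b hN hyz₁ hyz₁' n
  obtain ⟨w₀, hw₀⟩ := exists_evalₐ_honda_eq ι b hN hyz hyz₁ hyz₂ a e he n
  refine ⟨w₂ - ι a * w₁ + w₀, ?_⟩
  have hsplit : adicCompletionMap _ _ φ (map_span_natCast_le_self φ)
            (adicCompletionMap _ _ φ (map_span_natCast_le_self φ) (logSum ι b N y z)) -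
          AdicCompletion.of (Ideal.span {(p : B)}) B (ι a) *
            adicCompletionMap _ _ φ (map_span_natCast_le_self φ) (logSum ι b N y z) +
          AdicCompletion.of (Ideal.span {(p : B)}) B (p : B) * logSum ι b N y z =
      (logSum ι b N (y ^ (p ^ 2) + (p : B) * h₂) (φ (φ z)) - logSum ι b N (y ^ (p ^ 2)) ((p : B) ^ (p ^ 2 - 1) * z ^ (p ^ 2))) -
        AdicCompletion.of (Ideal.span {(p : B)}) B (ι a) *
          (logSum ι b N (y ^ p + (p : B) * h₁) (φ z) - logSum ι b N (y ^ p) ((p : B) ^ (p - 1) * z ^ p)) +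
        (AdicCompletion.of (Ideal.span {(p : B)}) B (p : B) * logSum ι b N y z -
          AdicCompletion.of (Ideal.span {(p : B)}) B (ι a) * logSum ι b N (y ^ p) ((p : B) ^ (p - 1) * z ^ p) +
          logSum ι b N (y ^ (p ^ 2)) ((p : B) ^ (p ^ 2 - 1) * z ^ (p ^ 2))) := by
    rw [e2, e1, hφφy, hφy]; ring
  rw [hsplit, map_add, map_sub, map_mul (AdicCompletion.evalₐ (Ideal.span {(p : B)}) n), hw₂, hw₁, hw₀,
    AdicCompletion.evalₐ_of, ← map_mul, ← map_sub, ← map_add]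
  congr 1
  ring

end Frobenius

end PadicLogSeries

end Literature.RingTheory.FormalGroups

end
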